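import Literature.NumberTheory.QuadraticFields.ThreeTorsion

/-!
# Triage r1-k2 scratch: the moment-LP lemma of card `moment-lp-density-floor` is provable now

`sixteen_mul_card_three_dvd_ge` exactly as typed in ideator 1's Sketch (over an ARBITRARY finset of
integers: the junk value of `quadFieldThreeTorsion` is `1 = 3⁰`, so the pointwise certificate
`12t − t² − 11 ≤ 16·[t > 1]` on powers of three applies everywhere).
-/

set_option linter.dupNamespace false

namespace Summit.QuantumAdvantage.QuantumAdvantage.Cruxes.AvgFaceBeyondPrior.TriageK2

open Literature.NumberTheory.QuadraticFields Finset

/-- Pointwise LP certificate on powers of three: `12·3^r − 9^r − 11 ≤ 16·[3^r > 1]`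
(equality at `r = 1, 2`). [folklore] -/
theorem lp_pointwise (r : ℕ) :
    12 * ((3:ℝ) ^ r) - ((3:ℝ) ^ r) ^ 2 - 11 ≤ 16 * (if 1 < 3 ^ r then (1:ℝ) else 0) := by
  rcases r with _ | _ | _ | r
  · norm_num
  · norm_num
  · norm_num
  · have h27 : (27:ℝ) ≤ (3:ℝ) ^ (r + 3) := by
      have : (3:ℝ) ^ 3 ≤ (3:ℝ) ^ (r + 3) := pow_le_pow_right₀ (by norm_num) (by omega)
      norm_num at this
      exact this
    have hlt : 1 < 3 ^ (r + 3) := Nat.one_lt_pow (by omega) (by norm_num)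
    rw [if_pos hlt]
    nlinarith [h27]

/-- **The moment LP** (card moment-lp-density-floor, First lemma, as typed):
`12 Σ t − Σ t² − 11 #S ≤ 16 · #{D ∈ S : 1 < t(D)}` for `t = quadFieldThreeTorsion`. [folklore] -/
theorem sixteen_mul_card_three_dvd_ge (S : Finset ℤ) :
    12 * (∑ D ∈ S, (quadFieldThreeTorsion D : ℝ)) - (∑ D ∈ S, ((quadFieldThreeTorsion D : ℝ)) ^ 2)
        - 11 * (S.card : ℝ)
      ≤ 16 * ((S.filter (fun D => 1 < quadFieldThreeTorsion D)).card : ℝ) := by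
  have hcard : ((S.filter (fun D => 1 < quadFieldThreeTorsion D)).card : ℝ)
      = ∑ D ∈ S, (if 1 < quadFieldThreeTorsion D then (1:ℝ) else 0) := by
    rw [Finset.sum_ite, Finset.sum_const_zero, add_zero, Finset.sum_const, nsmul_eq_mul, mul_one]
  have hS : (S.card : ℝ) = ∑ D ∈ S, (1:ℝ) := by
    rw [Finset.sum_const, nsmul_eq_mul, mul_one]
  rw [hcard, hS, Finset.mul_sum, Finset.mul_sum, Finset.mul_sum, ← Finset.sum_sub_distrib,
    ← Finset.sum_sub_distrib]
  refine Finset.sum_le_sum fun D _ => ?_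
  obtain ⟨r, hr⟩ := exists_quadFieldThreeTorsion_eq_pow D
  rw [hr]
  push_cast
  have := lp_pointwise r
  linarith

/-- Consequence in density form on a nonempty finset: with `m₁ = Σt/#S`, `m₂ = Σt²/#S`,
`#{1 < t}/#S ≥ (12 m₁ − m₂ − 11)/16`. [folklore] -/
theorem density_ge_of_moments (S : Finset ℤ) (hS : S.Nonempty) :
    (12 * ((∑ D ∈ S, (quadFieldThreeTorsion D : ℝ)) / S.card)
        - ((∑ D ∈ S, ((quadFieldThreeTorsion D : ℝ)) ^ 2) / S.card) - 11) / 16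
      ≤ ((S.filter (fun D => 1 < quadFieldThreeTorsion D)).card : ℝ) / S.card := by
  have hpos : (0:ℝ) < S.card := by exact_mod_cast hS.card_pos
  have h := sixteen_mul_card_three_dvd_ge S
  rw [div_le_div_iff₀ (by norm_num : (0:ℝ) < 16) hpos]
  have e1 : (12 * ((∑ D ∈ S, (quadFieldThreeTorsion D : ℝ)) / S.card)
        - ((∑ D ∈ S, ((quadFieldThreeTorsion D : ℝ)) ^ 2) / S.card) - 11) * S.card
      = 12 * (∑ D ∈ S, (quadFieldThreeTorsion D : ℝ)) - (∑ D ∈ S, ((quadFieldThreeTorsion D : ℝ)) ^ 2)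
        - 11 * (S.card : ℝ) := by
    field_simp
  rw [e1]
  linarith

/-- The first-moment ceiling (cards cubic-discriminant-pseudorandomness / moment-lp-density-floor,
`density_le_half_of_mean_two` in finite form): `2 · #{D ∈ S : 1 < t(D)} ≤ Σ t − #S`, since `t ≥ 3`
wherever `t > 1` and `t ≥ 1` everywhere; with the Davenport–Heilbronn mean `Σ t / #S → 2` this is the
δ-axis ceiling `dens(3 ∣ h) ≤ 1/2 + o(1)` the disprover can use against `AvgFaceAtDelta (1/2 + ε)`. [folklore] -/
theorem two_mul_card_three_dvd_le (S : Finset ℤ) :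
    2 * ((S.filter (fun D => 1 < quadFieldThreeTorsion D)).card : ℝ)
      ≤ (∑ D ∈ S, (quadFieldThreeTorsion D : ℝ)) - (S.card : ℝ) := by
  have hcard : ((S.filter (fun D => 1 < quadFieldThreeTorsion D)).card : ℝ)
      = ∑ D ∈ S, (if 1 < quadFieldThreeTorsion D then (1:ℝ) else 0) := by
    rw [Finset.sum_ite, Finset.sum_const_zero, add_zero, Finset.sum_const, nsmul_eq_mul, mul_one]
  have hS : (S.card : ℝ) = ∑ D ∈ S, (1:ℝ) := by
    rw [Finset.sum_const, nsmul_eq_mul, mul_one]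
  rw [hcard, hS, Finset.mul_sum, ← Finset.sum_sub_distrib]
  refine Finset.sum_le_sum fun D _ => ?_
  obtain ⟨r, hr⟩ := exists_quadFieldThreeTorsion_eq_pow D
  rw [hr]
  push_cast
  rcases r with _ | r
  · norm_num
  · have h3 : (3:ℝ) ≤ (3:ℝ) ^ (r + 1) := by
      have : (3:ℝ) ^ 1 ≤ (3:ℝ) ^ (r + 1) := pow_le_pow_right₀ (by norm_num) (by omega)
      simpa using this
    have hlt : 1 < 3 ^ (r + 1) := Nat.one_lt_pow (by omega) (by norm_num)
    rw [if_pos hlt]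
    linarith

end Summit.QuantumAdvantage.QuantumAdvantage.Cruxes.AvgFaceBeyondPrior.TriageK2
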